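import Summits.KontsevichZagierPeriods.KontsevichZagierPeriods.Theses.SymplecticScissors

/-!
# Route SymplecticScissors — converse of `FrameSplit` (supports item stmt-KontsevichZagierPeriods-14942)

`FrameSplit` (`frameSplit_proof`) assembles the frame `VolumeForm` from its planar layer
`PlanarAreas` (`N = 2`) and its off-plane part `VolumeFormOffPlane` (`N ≠ 2`). Here we record the
converse restrictions, so that the split is visibly lossless:
`VolumeForm ↔ PlanarAreas ∧ VolumeFormOffPlane`.
-/

namespace Summit.KontsevichZagierPeriods.SymplecticScissors

open Summit.KontsevichZagierPeriods.KontsevichZagierPeriods.Theses.SymplecticScissors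

/-- The frame is exactly the conjunction of its planar layer and its off-plane part:
`VolumeForm ↔ PlanarAreas ∧ VolumeFormOffPlane`. Forward: specialise the frame to dimension `2`,
respectively forget the hypothesis `N ≠ 2`; backward: `frameSplit_proof`. -/
theorem volumeForm_iff_planarAreas_and_offPlane :
    VolumeForm ↔ PlanarAreas ∧ VolumeFormOffPlane := by
  -- backward direction inlined (the route decl `FrameSplit` was dropped, so the former module
  -- `SymplecticScissorsFrameSplit` providing `frameSplit_proof` no longer builds): case split on `N = 2`
  refine ⟨fun hV => ⟨?_, ?_⟩, fun h => ?_⟩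
  · intro r r' hr hr' hv
    exact hV r r' hr hr' hv
  · intro N _hN r r' hr hr' hv
    exact hV r r' hr hr' hv
  · intro N r r' hr hr' hv
    by_cases hN : N = 2
    · subst hN
      exact h.1 r r' hr hr' hv
    · exact h.2 hN r r' hr hr' hv

end Summit.KontsevichZagierPeriods.SymplecticScissors
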